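import Summits.Parity.GeneralizedHardyLittlewood.Theorems.LiouvilleShiftedTablesTypeI2DilatedURB2
import Summits.Parity.GeneralizedHardyLittlewood.Theorems.LiouvilleShiftedTablesTypeI2DilatedURB4
import Summits.Parity.GeneralizedHardyLittlewood.Theorems.LiouvilleShiftedTablesTypeI2DilatedURB7
import Literature.NumberTheory.Sieve.DrappeauTypeICore

/-!
# The `𝔲_R` terms of the assembly (`stub_uRBound`), file 8: the Type I bound for one `(q, r, ν)`

Route `LiouvilleShiftedTables` (Parity / GeneralizedHardyLittlewood), crux `TypeI2Dilated` (stmt-Parity-14272), line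
`peel-to-drappeau`, registered stub `stub_uRBound : URBound`; continuation of `…URB1`–`…URB7`.

The quantity `B(q, r, ν) = ∑_{s ∈ sRange} ‖∑_{n⃗ : nₜ ∼ Wₜ} [ν ∏ nₜ ∈ classFilter] 𝔲_{x^{40ρ}}(ν ∏ nₜ c̄; s)‖` of `…URB6` is
bounded by Drappeau's Type I estimate `Literature…DrappeauTypeI.typeI_core` (Fouvry–Tenenbaum's Lemmas 4.12/4.13 enter as
the hypothesis `DivisorAPTuple k (1/2 + 1/85)`, `k ≤ 2`): for `0 < ρ ≤ ρ₂(k) = min(1/6000, δ'/(2000 + 10 C₀))`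
(`δ' = min(δ, 1/2)`) and `x ≥ x₀`, in the regime of `URBound` with `0 ≤ Y ≤ 2x`, scales `Wₜ > x^{1/3−1/50}` and
`1 ≤ ν ≤ 2^8 x^{1/50}`: `B(q, r, ν) ≤ x^{1−12ρ}/ν` (`typeI_B_le`).  Parameters: `x_F = 2x/ν`, `V_min = x^{1/3−1/50}`,
`G₀ = ⌈x^{120ρ}⌉`, `H = ⌈x^{500ρ}⌉`, `L = qrP`, `W(m) = [m ≡ c (rP)] ∧ [m ≡ w + c (q)]`, `Rd = x^{40ρ}`, `Z = x³`,
`Dv = x^ρ`; if `ν ∏ Wₜ ≥ Y` every term fails the window and `B = 0`; the numerics are `typeI_numerics` (`…URB7`).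
[this line: Lines/peel-to-drappeau.md; cite: Drappeau2017, §6.2; FouvryTenenbaum2021, Lemmas 4.12–4.13]
-/

noncomputable section

namespace Summit.Parity.GeneralizedHardyLittlewood.Cruxes.TypeI2Dilated.PeelToDrappeau

open Finset Fintype Real Filter
open scoped ArithmeticFunction.sigma Classical
open Literature.NumberTheory.Sieve Literature.NumberTheory.Sieve.Drappeau2017
  Literature.NumberTheory.Sieve.FouvryTenenbaum2021 Literature.NumberTheory.Sieve.DrappeauTypeI

/-! ### Small lemmas -/

/-- `#{s ∈ 𝒮 : s ∣ z} ≤ τ(|z|)` for `z ≠ 0`. [folklore] -/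
theorem card_filter_dvd_le_sigma (𝒮 : Finset ℕ) {z : ℤ} (hz : z ≠ 0) :
    (𝒮.filter (fun s : ℕ => (s : ℤ) ∣ z)).card ≤ σ 0 z.natAbs := by
  rw [ArithmeticFunction.sigma_zero_apply]
  refine Finset.card_le_card fun s hs => ?_
  rw [Finset.mem_filter] at hs
  exact Nat.mem_divisors.2 ⟨Int.natCast_dvd.1 hs.2, Int.natAbs_ne_zero.2 hz⟩

/-- The two class conditions depend on `m mod qr` only. [folklore] -/
theorem classes_periodic (c : ℤ) (q w r : ℕ) {m m' : ℕ} (h : (m : ZMod (q * r)) = (m' : ZMod (q * r))) :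
    ((m : ZMod r) = ((c : ℤ) : ZMod r) ∧ (m : ZMod q) = (((w : ℤ) + c : ℤ) : ZMod q)) ↔
      ((m' : ZMod r) = ((c : ℤ) : ZMod r) ∧ (m' : ZMod q) = (((w : ℤ) + c : ℤ) : ZMod q)) := by
  have hmod := (ZMod.natCast_eq_natCast_iff _ _ _).1 h
  have hr : (m : ZMod r) = (m' : ZMod r) := (ZMod.natCast_eq_natCast_iff _ _ _).2 (hmod.of_dvd (dvd_mul_left r q))
  have hq : (m : ZMod q) = (m' : ZMod q) := (ZMod.natCast_eq_natCast_iff _ _ _).2 (hmod.of_dvd (dvd_mul_right q r))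
  rw [hr, hq]

/-- The summand of `B(q, r, ν)` in the form of `typeI_core`: class condition outside, window inside `coreTerm`. [this line] -/
theorem classFilter_ite_eq (c : ℤ) (q w r : ℕ) (Y Rd : ℝ) (s ν : ℕ) {N : ℕ} (hN : 0 < ν * N) :
    (if ν * N ∈ classFilter c q w r Y then uR Rd s (((ν * N : ℕ) : ZMod s) * ((c : ZMod s))⁻¹) else 0) =
      (if ((ν * N : ℕ) : ZMod r) = ((c : ℤ) : ZMod r) ∧ ((ν * N : ℕ) : ZMod q) = (((w : ℤ) + c : ℤ) : ZMod q)
        then coreTerm ν Y Rd c s N else 0) := by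
  have hN0 : (0 : ℝ) < ((ν * N : ℕ) : ℝ) := by exact_mod_cast hN
  by_cases hCF : ν * N ∈ classFilter c q w r Y
  · obtain ⟨-, hY, hW⟩ := (mem_classFilter_iff' c q w r Y _).1 hCF
    rw [if_pos hCF, if_pos hW, coreTerm, if_pos hY]
  · rw [if_neg hCF]
    by_cases hW : ((ν * N : ℕ) : ZMod r) = ((c : ℤ) : ZMod r) ∧ ((ν * N : ℕ) : ZMod q) = (((w : ℤ) + c : ℤ) : ZMod q)
    · rw [if_pos hW, coreTerm, if_neg]
      exact fun hY => hCF ((mem_classFilter_iff' c q w r Y _).2 ⟨hN0, hY, hW⟩)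
    · rw [if_neg hW]

/-- If `ν ∏ Wₜ ≥ Y` then every tuple fails the window and `B(q, r, ν) = 0`. [this line] -/
theorem tuple_sum_eq_zero_of_window {k : ℕ} {W : Fin (k + 1) → ℝ} (hW : ∀ t, 0 < W t) {ν : ℕ} (hν : 1 ≤ ν) {Y : ℝ}
    (hY : Y ≤ ν * ∏ t, W t) (c : ℤ) (q w r : ℕ) (Rd : ℝ) (s : ℕ) :
    ∑ n ∈ piFinset (fun t => BFI.dyadic (W t)),
      (if ν * ∏ t, n t ∈ classFilter c q w r Y then uR Rd s (((ν * ∏ t, n t : ℕ) : ZMod s) * ((c : ZMod s))⁻¹)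
        else 0) = 0 := by
  refine Finset.sum_eq_zero fun n hn => if_neg fun hCF => ?_
  obtain ⟨-, hle, -⟩ := (mem_classFilter_iff' c q w r Y _).1 hCF
  have hlt : ∏ t, W t < ∏ t, (n t : ℝ) :=
    Finset.prod_lt_prod_of_nonempty (fun t _ => hW t)
      (fun t _ => ((BFI.mem_dyadic (hW t).le).1 (Fintype.mem_piFinset.1 hn t)).1) Finset.univ_nonempty
  have hν0 : (1 : ℝ) ≤ ν := by exact_mod_cast hν
  have : (ν : ℝ) * ∏ t, W t < ν * ∏ t, (n t : ℝ) := mul_lt_mul_of_pos_left hlt (by linarith)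
  push_cast at hle
  linarith

/-! ### The Type I bound -/

set_option maxHeartbeats 1000000 in
/-- **The Type I bound for one `(q, r, ν)`** (see the module docstring; a long bookkeeping proof, hence the raised
heartbeat limit). [this line; cite: Drappeau2017, §6.2] -/
theorem typeI_B_le {k : ℕ} (hk : k ≤ 2) (hFTk : DivisorAPTuple k (1 / 2 + 1 / 85)) (c : ℤ) :
    ∃ ρ₂ : ℝ, 0 < ρ₂ ∧ ∀ ρ : ℝ, 0 < ρ → ρ ≤ ρ₂ → ∃ x₀ : ℝ, ∀ x : ℝ, x₀ ≤ x →
      ∀ w : ℕ, ∀ Y R Slo : ℝ, ∀ P : ℕ, 1 ≤ P → 0 ≤ Y → Y ≤ 2 * x → 1 ≤ R → (P : ℝ) * R ≤ x ^ (4 * ρ) →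
        0 ≤ Slo → 2 * Slo * R * P ≤ x ^ (1 / 2 + ρ) →
      ∀ q ∈ Icc 1 ⌊x ^ ρ⌋₊, ∀ r ∈ Icc 1 ⌊R⌋₊, ∀ W : Fin (k + 1) → ℝ, (∀ t, x ^ (1 / 3 - 1 / 50 : ℝ) < W t) →
      ∀ ν ∈ Icc 1 ⌊(2 : ℝ) ^ 8 * x ^ (1 / 50 : ℝ)⌋₊,
        ∑ s ∈ sRange c q (r * P) Slo (2 * Slo), ‖∑ n ∈ piFinset (fun t => BFI.dyadic (W t)),
          (if ν * ∏ t, n t ∈ classFilter c q w (r * P) Y then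
            uR (x ^ (40 * ρ)) s (((ν * ∏ t, n t : ℕ) : ZMod s) * ((c : ZMod s))⁻¹) else 0)‖ ≤
          x ^ (1 - 12 * ρ) / ν := by
  obtain ⟨δ, C₀, C, hδ, hC₀, hC, hbody⟩ := hFTk
  set d : ℝ := min δ (1 / 2) with hd
  have hd0 : 0 < d := lt_min hδ (by norm_num)
  have hdδ : d ≤ δ := min_le_left _ _
  have hden : 0 < 2000 + 10 * C₀ := by linarith
  refine ⟨min (1 / 6000) (d / (2000 + 10 * C₀)), lt_min (by norm_num) (div_pos hd0 hden), fun ρ hρ hρle => ?_⟩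
  have hρ1 : ρ ≤ 1 / 6000 := hρle.trans (min_le_left _ _)
  have hρd : ρ * (2000 + 10 * C₀) ≤ d := (le_div_iff₀ hden).1 (hρle.trans (min_le_right _ _))
  -- constants: divisor bound with `ε = ρ/6`, `Ψ₁ ≤ C₁ log⁸`, `Ψ ≤ C₂ log¹⁶`
  obtain ⟨Cτ, -, hCτ⟩ := exists_sigma_zero_le_mul_rpow (show 0 < ρ / 6 by linarith)
  obtain ⟨C₁, -, hΨ₁C⟩ := exists_psiOne_le
  obtain ⟨C₂, -, hΨC⟩ := exists_sum_sigma_zero_pow_div_totient_le_real 2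
  have hev : ∀ᶠ x : ℝ in atTop, 64 * C ≤ x ^ (7 * d / 100) ∧ (64 : ℝ) ≤ x ^ (111 * ρ) ∧
      (256 : ℝ) ≤ x ^ (1 / 5 : ℝ) ∧ (100 : ℝ) ≤ x ^ ρ ∧ C₁ * Real.log x ^ 8 ≤ x ^ ρ ∧
      C₂ * Real.log x ^ 16 ≤ x ^ ρ ∧ Cτ ≤ x ^ (ρ / 2) ∧ (2 : ℝ) ^ 8 ≤ x ^ (1 / 100 : ℝ) ∧
      (2 : ℝ) ≤ x ^ (41 / 150 : ℝ) ∧ 2 * |(c : ℝ)| ≤ x ^ (44 / 150 : ℝ) ∧ (16 : ℝ) ≤ x ^ (1 / 1000 : ℝ) ∧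
      |(c : ℝ)| ≤ x ∧ (256 : ℝ) ≤ x := by
    refine (eventually_le_rpow _ (by positivity)).and ((eventually_le_rpow _ (by linarith)).and
      ((eventually_le_rpow _ (by norm_num)).and ((eventually_le_rpow _ hρ).and
      ((eventually_mul_log_pow_le _ 8 hρ).and ((eventually_mul_log_pow_le _ 16 hρ).and
      ((eventually_le_rpow _ (by linarith)).and ((eventually_le_rpow _ (by norm_num)).and
      ((eventually_le_rpow _ (by norm_num)).and ((eventually_le_rpow _ (by norm_num)).and
      ((eventually_le_rpow _ (by norm_num)).and ((eventually_ge_atTop _).and (eventually_ge_atTop _))))))))))))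
  obtain ⟨x₀, hx₀⟩ := Filter.eventually_atTop.1 hev
  refine ⟨x₀, fun x hx w Y R Slo P hP hY0 hY hR hPR hSlo hSRP q hq r hr W hWt ν hν => ?_⟩
  obtain ⟨e1, e2, e3, e4, e5, e6, e7, e8, e9, e10, e11, e12, e13⟩ := hx₀ x hx
  have hx1 : 1 ≤ x := by linarith
  have hx0 : 0 < x := by linarith
  have hmul : ∀ a b : ℝ, x ^ a * x ^ b = x ^ (a + b) := fun a b => (Real.rpow_add hx0 a b).symm
  have hexp : ∀ {a b : ℝ}, a ≤ b → x ^ a ≤ x ^ b := fun h => Real.rpow_le_rpow_of_exponent_le hx1 h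
  have hxpos : ∀ a : ℝ, 0 < x ^ a := fun a => Real.rpow_pos_of_pos hx0 a
  have hx_one : x ^ (1 : ℝ) = x := Real.rpow_one x
  rw [Finset.mem_Icc] at hq hr hν
  -- the variables `q, r, ν`
  have hqle : (q : ℝ) ≤ x ^ ρ := le_trans (by exact_mod_cast hq.2) (Nat.floor_le (hxpos _).le)
  have hP1 : (1 : ℝ) ≤ P := by exact_mod_cast hP
  have hrP : (r : ℝ) * P ≤ x ^ (4 * ρ) := by
    have h1 : (r : ℝ) ≤ R := le_trans (by exact_mod_cast hr.2) (Nat.floor_le (by linarith))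
    calc (r : ℝ) * P ≤ R * P := mul_le_mul_of_nonneg_right h1 (by linarith)
      _ = P * R := mul_comm _ _
      _ ≤ _ := hPR
  have hν1 : (1 : ℝ) ≤ ν := by exact_mod_cast hν.1
  have hν0 : (0 : ℝ) < ν := by linarith
  have hν28 : (ν : ℝ) ≤ (2 : ℝ) ^ 8 * x ^ (1 / 50 : ℝ) := le_trans (by exact_mod_cast hν.2) (Nat.floor_le (by positivity))
  have hνle : (ν : ℝ) ≤ x ^ (3 / 100 : ℝ) := by
    calc (ν : ℝ) ≤ (2 : ℝ) ^ 8 * x ^ (1 / 50 : ℝ) := hν28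
      _ ≤ x ^ (1 / 100 : ℝ) * x ^ (1 / 50 : ℝ) := mul_le_mul_of_nonneg_right e8 (hxpos _).le
      _ = x ^ (3 / 100 : ℝ) := by rw [hmul]; norm_num
  have hνx : (ν : ℝ) ≤ x := hνle.trans ((hexp (show (3 / 100 : ℝ) ≤ 1 by norm_num)).trans hx_one.le)
  -- `x_F = 2x/ν` (made opaque after its defining facts)
  have hxFν : (2 * x / ν) * ν = 2 * x := by field_simp
  have hxF2 : 2 ≤ 2 * x / ν := by rw [le_div_iff₀ hν0]; nlinarith
  have hxFle : 2 * x / ν ≤ 2 * x := div_le_self (by linarith) hν1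
  have hXF : (2 * x / ν) ^ (1 - δ) ≤ 2 * x ^ (1 - 97 * d / 100) / ν := rpow_one_sub_le_of hx1 hν1 hνle hd0 hdδ
  have hxFθ : x ^ (1 / 2 + ρ) ≤ (2 * x / ν) ^ (1 / 2 + 1 / 85 : ℝ) := le_xF_rpow_theta hx1 hν0 hν28 hρ1 e11
  generalize 2 * x / ν = xF at hxFν hxF2 hxFle hXF hxFθ
  have hxF1 : 1 ≤ xF := by linarith
  have hxF0 : 0 < xF := by linarith
  -- the case `ν ∏ W ≥ Y`: everything vanishes
  have hW0 : ∀ t, 0 < W t := fun t => (hxpos _).trans (hWt t)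
  by_cases hwin : Y ≤ ν * ∏ t, W t
  · rw [Finset.sum_eq_zero fun s _ => by rw [tuple_sum_eq_zero_of_window hW0 hν.1 hwin, norm_zero]]
    positivity
  push Not at hwin
  have hνW : (ν : ℝ) * ∏ t, W t ≤ 2 * x := by linarith
  have hprodW : ∏ t, W t ≤ xF := by
    have h1 : (∏ t, W t) * ν ≤ xF * ν := by rw [hxFν]; linarith
    exact le_of_mul_le_mul_right h1 hν0
  -- `G₀`, `H`
  obtain ⟨hG₀1, hG1, hG2⟩ := ceil_rpow_bounds hx1 (show 0 ≤ 120 * ρ by linarith)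
  obtain ⟨hH₀1, hH1, hH2⟩ := ceil_rpow_bounds hx1 (show 0 ≤ 500 * ρ by linarith)
  generalize ⌈x ^ (120 * ρ)⌉₊ = G₀ at hG₀1 hG1 hG2
  generalize ⌈x ^ (500 * ρ)⌉₊ = H at hH₀1 hH1 hH2
  have hGr1 : (1 : ℝ) ≤ G₀ := by exact_mod_cast hG₀1
  have hG3 : (G₀ : ℝ) ≤ 2 * x ^ (1 / 50 : ℝ) := hG2.trans (by linarith [hexp (show 120 * ρ ≤ 1 / 50 by linarith)])
  -- the scales
  have hVminV : ∀ t, x ^ (1 / 3 - 1 / 50 : ℝ) ≤ W t := fun t => (hWt t).le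
  have hxF100 : xF ^ (1 / 100 : ℝ) ≤ x ^ (1 / 50 : ℝ) := by
    have h2x : (2 * x) ^ (1 / 100 : ℝ) = 2 ^ (1 / 100 : ℝ) * x ^ (1 / 100 : ℝ) := Real.mul_rpow (by norm_num) hx0.le
    have h21 : (2 : ℝ) ^ (1 / 100 : ℝ) ≤ x ^ (1 / 100 : ℝ) := Real.rpow_le_rpow (by norm_num) (by linarith) (by norm_num)
    calc xF ^ (1 / 100 : ℝ) ≤ (2 * x) ^ (1 / 100 : ℝ) := Real.rpow_le_rpow hxF0.le hxFle (by norm_num)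
      _ ≤ x ^ (1 / 100 : ℝ) * x ^ (1 / 100 : ℝ) := by rw [h2x]; gcongr
      _ = x ^ (1 / 50 : ℝ) := by rw [hmul]; norm_num
  have hV1 : ∀ t, xF ^ (1 / 100 : ℝ) * G₀ ≤ W t := by
    intro t
    refine le_trans ?_ (hWt t).le
    calc xF ^ (1 / 100 : ℝ) * G₀ ≤ x ^ (1 / 50 : ℝ) * (2 * x ^ (1 / 50 : ℝ)) :=
          mul_le_mul hxF100 hG3 (Nat.cast_nonneg _) (hxpos _).le
      _ = 2 * (x ^ (1 / 50 : ℝ) * x ^ (1 / 50 : ℝ)) := by ring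
      _ ≤ x ^ (41 / 150 : ℝ) * (x ^ (1 / 50 : ℝ) * x ^ (1 / 50 : ℝ)) := mul_le_mul_of_nonneg_right e9 (by positivity)
      _ = x ^ (1 / 3 - 1 / 50 : ℝ) := by rw [hmul, hmul]; norm_num
  have hcV : ∀ t, (|c| : ℝ) * G₀ ≤ W t := by
    intro t
    refine le_trans ?_ (hWt t).le
    calc (|c| : ℝ) * G₀ ≤ |(c : ℝ)| * (2 * x ^ (1 / 50 : ℝ)) := mul_le_mul_of_nonneg_left hG3 (abs_nonneg _)
      _ = (2 * |(c : ℝ)|) * x ^ (1 / 50 : ℝ) := by ring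
      _ ≤ x ^ (44 / 150 : ℝ) * x ^ (1 / 50 : ℝ) := mul_le_mul_of_nonneg_right e10 (hxpos _).le
      _ = x ^ (1 / 3 - 1 / 50 : ℝ) := by rw [hmul]; norm_num
  -- the modulus `L = q r P` and the classes
  have hL1 : 1 ≤ q * (r * P) :=
    Nat.one_le_iff_ne_zero.2 (Nat.mul_ne_zero (by omega) (Nat.mul_ne_zero (by omega) (by omega)))
  have hLr1 : (1 : ℝ) ≤ ((q * (r * P) : ℕ) : ℝ) := by exact_mod_cast hL1
  have hLle : ((q * (r * P) : ℕ) : ℝ) ≤ x ^ (5 * ρ) := by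
    push_cast
    calc (q : ℝ) * (r * P) ≤ x ^ ρ * x ^ (4 * ρ) := mul_le_mul hqle hrP (by positivity) (hxpos _).le
      _ = x ^ (5 * ρ) := by rw [hmul]; ring_nf
  have hWper : ∀ m m' : ℕ, (m : ZMod (q * (r * P))) = (m' : ZMod (q * (r * P))) →
      (((m : ZMod (r * P)) = ((c : ℤ) : ZMod (r * P)) ∧ (m : ZMod q) = (((w : ℤ) + c : ℤ) : ZMod q)) ↔
       ((m' : ZMod (r * P)) = ((c : ℤ) : ZMod (r * P)) ∧ (m' : ZMod q) = (((w : ℤ) + c : ℤ) : ZMod q))) :=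
    fun m m' h => classes_periodic c q w (r * P) h
  -- the moduli
  have h2Slo : 2 * Slo ≤ x ^ (1 / 2 + ρ) := by
    have hRP : 1 ≤ R * P := one_le_mul_of_one_le_of_one_le hR hP1
    calc 2 * Slo ≤ 2 * Slo * (R * P) := le_mul_of_one_le_right (by linarith) hRP
      _ = 2 * Slo * R * P := by ring
      _ ≤ _ := hSRP
  have h2Slox : 2 * Slo ≤ x := h2Slo.trans ((hexp (show 1 / 2 + ρ ≤ 1 by linarith)).trans hx_one.le)
  have h𝒮 : ∀ s ∈ sRange c q (r * P) Slo (2 * Slo),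
      1 ≤ s ∧ s.Coprime (q * (r * P)) ∧ IsCoprime (s : ℤ) c ∧ (s : ℝ) ≤ xF ^ (1 / 2 + 1 / 85 : ℝ) := by
    intro s hs
    obtain ⟨⟨hs1, hs2⟩, -, hcop, hsc⟩ := mem_sRange.1 hs
    refine ⟨hs1, hcop, hsc, ?_⟩
    have : (s : ℝ) ≤ 2 * Slo := le_trans (by exact_mod_cast hs2) (Nat.floor_le (by linarith))
    exact this.trans (h2Slo.trans hxFθ)
  -- `Z = x³` and the divisor count `Dv = x^ρ`
  have hx3 : x ^ (3 : ℝ) = x * x * x := by rw [show (3 : ℝ) = ((3 : ℕ) : ℝ) by norm_num, Real.rpow_natCast]; ring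
  have hZ1 : (2 : ℝ) ^ (k + 2) * ν * (G₀ : ℝ) ^ (k + 1) * xF ≤ x ^ (3 : ℝ) := by
    have h1 : (G₀ : ℝ) ^ (k + 1) ≤ 8 * x := by
      calc (G₀ : ℝ) ^ (k + 1) ≤ (G₀ : ℝ) ^ 3 := pow_le_pow_right₀ hGr1 (by omega)
        _ ≤ (2 * x ^ (1 / 50 : ℝ)) ^ 3 := pow_le_pow_left₀ (Nat.cast_nonneg _) hG3 3
        _ = 8 * x ^ (3 * (1 / 50 : ℝ)) := by rw [mul_pow, pow_rpow_eq hx0.le]; norm_num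
        _ ≤ 8 * x := by
            have : x ^ (3 * (1 / 50 : ℝ)) ≤ x := (hexp (by norm_num)).trans hx_one.le
            linarith
    have h4 : (2 : ℝ) ^ (k + 2) ≤ 16 := by
      calc (2 : ℝ) ^ (k + 2) ≤ 2 ^ 4 := pow_le_pow_right₀ (by norm_num) (by omega)
        _ = 16 := by norm_num
    calc (2 : ℝ) ^ (k + 2) * ν * (G₀ : ℝ) ^ (k + 1) * xF = 2 ^ (k + 2) * (G₀ : ℝ) ^ (k + 1) * (xF * ν) := by ring
      _ ≤ 16 * (8 * x) * (2 * x) := by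
          rw [hxFν]; exact mul_le_mul (mul_le_mul h4 h1 (by positivity) (by norm_num)) le_rfl (by positivity) (by positivity)
      _ = 256 * (x * x) := by ring
      _ ≤ x * (x * x) := mul_le_mul_of_nonneg_right e13 (by positivity)
      _ = x ^ (3 : ℝ) := by rw [hx3]; ring
  have hZ2 : (ν : ℝ) * (2 ^ (k + 1) * ∏ t, W t) + ((|c| : ℤ) : ℝ) ≤ x ^ (3 : ℝ) := by
    rw [Int.cast_abs]
    have h1 : (2 : ℝ) ^ (k + 1) ≤ 8 := by
      calc (2 : ℝ) ^ (k + 1) ≤ 2 ^ 3 := pow_le_pow_right₀ (by norm_num) (by omega)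
        _ = 8 := by norm_num
    have hP0 : 0 ≤ ∏ t, W t := Finset.prod_nonneg fun t _ => (hW0 t).le
    calc (ν : ℝ) * (2 ^ (k + 1) * ∏ t, W t) + |(c : ℝ)| = 2 ^ (k + 1) * (ν * ∏ t, W t) + |(c : ℝ)| := by ring
      _ ≤ 8 * (2 * x) + x := add_le_add (mul_le_mul h1 hνW (by positivity) (by norm_num)) e12
      _ = 17 * x := by ring
      _ ≤ x * x * x := by nlinarith
      _ = x ^ (3 : ℝ) := hx3.symm
  have hDv : ∀ z : ℤ, z ≠ 0 → (|z| : ℝ) ≤ x ^ (3 : ℝ) →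
      (((sRange c q (r * P) Slo (2 * Slo)).filter (fun s : ℕ => (s : ℤ) ∣ z)).card : ℝ) ≤ x ^ ρ := by
    intro z hz hzle
    have h2 : ((z.natAbs : ℕ) : ℝ) = |(z : ℝ)| := by rw [Nat.cast_natAbs, Int.cast_abs]
    calc _ ≤ ((σ 0 z.natAbs : ℕ) : ℝ) := by exact_mod_cast card_filter_dvd_le_sigma (sRange c q (r * P) Slo (2 * Slo)) hz
      _ ≤ x ^ ρ := sigma_le_rpow_of hx0 hρ.le hCτ e7 (by rw [h2]; exact hzle)
  -- apply the core estimate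
  have hRd : (1 : ℝ) ≤ x ^ (40 * ρ) := Real.one_le_rpow hx1 (by linarith)
  have key := typeI_core hbody hC hxF1 (V := W) (hxpos _) hVminV hG₀1 hV1 hcV hprodW hL1 _ hWper hν.1 hY0 hH₀1
    hRd (sRange c q (r * P) Slo (2 * Slo)) h𝒮 hZ1 hZ2 hDv
  clear hbody
  -- identify the left sides
  have hlhs : ∀ s ∈ sRange c q (r * P) Slo (2 * Slo), ∑ n ∈ piFinset (fun t => BFI.dyadic (W t)),
      (if ν * ∏ t, n t ∈ classFilter c q w (r * P) Y then
        uR (x ^ (40 * ρ)) s (((ν * ∏ t, n t : ℕ) : ZMod s) * ((c : ZMod s))⁻¹) else 0) =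
      ∑ n ∈ piFinset (fun t => BFI.dyadic (W t)),
        (if ((ν * ∏ t, n t : ℕ) : ZMod (r * P)) = ((c : ℤ) : ZMod (r * P)) ∧
            ((ν * ∏ t, n t : ℕ) : ZMod q) = (((w : ℤ) + c : ℤ) : ZMod q)
          then coreTerm ν Y (x ^ (40 * ρ)) c s (∏ t, n t) else 0) := by
    intro s _
    refine Finset.sum_congr rfl fun n hn => ?_
    have hN : 0 < ν * ∏ t, n t := Nat.mul_pos hν.1 (Finset.prod_pos fun t _ =>
      BFI.pos_of_mem_dyadic (hW0 t).le (Fintype.mem_piFinset.1 hn t))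
    rw [classFilter_ite_eq c q w (r * P) Y (x ^ (40 * ρ)) s ν hN]
  rw [Finset.sum_congr rfl fun s hs => by rw [hlhs s hs]]
  refine (le_of_eq_of_le (Finset.sum_congr rfl fun s _ => by rfl) key).trans ?_
  -- the numerics
  have hsub := sRange_subset c q (r * P) Slo (2 * Slo)
  have hΨ₁le : ∑ s ∈ sRange c q (r * P) Slo (2 * Slo), (σ 0 s : ℝ) / (Nat.totient s : ℝ) ≤ x ^ ρ := by
    calc _ ≤ psiOne (2 * Slo) := Finset.sum_le_sum_of_subset_of_nonneg hsub fun _ _ _ => by positivity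
      _ ≤ psiOne x := psiOne_mono h2Slox
      _ ≤ C₁ * Real.log x ^ 8 := hΨ₁C x (by linarith)
      _ ≤ x ^ ρ := e5
  have hΦle : ∑ s ∈ sRange c q (r * P) Slo (2 * Slo), ((Nat.totient s : ℝ))⁻¹ ≤ x ^ ρ := by
    refine le_trans (Finset.sum_le_sum fun s hs => ?_) hΨ₁le
    obtain ⟨⟨hs1, -⟩, -⟩ := mem_sRange.1 hs
    have hφ : (0 : ℝ) < Nat.totient s := by exact_mod_cast Nat.totient_pos.2 hs1
    rw [inv_eq_one_div]
    exact div_le_div_of_nonneg_right (by exact_mod_cast one_le_sigma_zero (by omega)) hφ.le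
  have hΨle : ∑ s ∈ sRange c q (r * P) Slo (2 * Slo), (σ 0 s : ℝ) ^ 2 / (Nat.totient s : ℝ) ≤ x ^ ρ := by
    calc _ ≤ ∑ s ∈ Icc 1 ⌊x⌋₊, (σ 0 s : ℝ) ^ 2 / (Nat.totient s : ℝ) :=
          Finset.sum_le_sum_of_subset_of_nonneg (hsub.trans (Finset.Icc_subset_Icc_right (Nat.floor_le_floor h2Slox)))
            fun _ _ _ => by positivity
      _ ≤ C₂ * Real.log x ^ (2 ^ (2 + 2)) := hΨC x (by linarith)
      _ = C₂ * Real.log x ^ 16 := by norm_num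
      _ ≤ x ^ ρ := e6
  have hGLk : ((G₀ : ℝ) * ((q * (r * P) : ℕ) : ℝ)) ^ (k + 1) ≤ 8 * x ^ (375 * ρ) := by
    have hGL : (G₀ : ℝ) * ((q * (r * P) : ℕ) : ℝ) ≤ 2 * x ^ (125 * ρ) := by
      calc _ ≤ (2 * x ^ (120 * ρ)) * x ^ (5 * ρ) := mul_le_mul hG2 hLle (Nat.cast_nonneg _) (by positivity)
        _ = 2 * x ^ (125 * ρ) := by rw [mul_assoc, hmul]; ring_nf
    calc _ ≤ ((G₀ : ℝ) * ((q * (r * P) : ℕ) : ℝ)) ^ 3 := pow_le_pow_right₀ (one_le_mul_of_one_le_of_one_le hGr1 hLr1) (by omega)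
      _ ≤ (2 * x ^ (125 * ρ)) ^ 3 := pow_le_pow_left₀ (by positivity) hGL 3
      _ = 8 * x ^ (375 * ρ) := by rw [mul_pow, pow_rpow_eq hx0.le]; ring_nf
  have hHk : (H : ℝ) ^ k ≤ 4 * x ^ (1000 * ρ) := by
    calc (H : ℝ) ^ k ≤ (H : ℝ) ^ 2 := pow_le_pow_right₀ (by exact_mod_cast hH₀1) hk
      _ ≤ (2 * x ^ (500 * ρ)) ^ 2 := pow_le_pow_left₀ (Nat.cast_nonneg _) hH2 2
      _ = 4 * x ^ (1000 * ρ) := by rw [mul_pow, pow_rpow_eq hx0.le]; ring_nf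
  have hLC₀ : ((q * (r * P) : ℕ) : ℝ) ^ C₀ ≤ x ^ (5 * C₀ * ρ) := by
    calc _ ≤ (x ^ (5 * ρ)) ^ C₀ := Real.rpow_le_rpow (Nat.cast_nonneg _) hLle hC₀
      _ = x ^ (5 * C₀ * ρ) := by rw [← Real.rpow_mul hx0.le]; ring_nf
  have hk2 : (k : ℝ) ≤ 2 := by exact_mod_cast hk
  have hA2 : (k : ℝ) * Y / (ν * H) ≤ 4 * x ^ (1 - 500 * ρ) / ν := by
    have hH0 : (0 : ℝ) < H := by exact_mod_cast hH₀1
    rw [div_le_div_iff₀ (by positivity) hν0]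
    calc (k : ℝ) * Y * ν ≤ 2 * (2 * x) * ν := mul_le_mul_of_nonneg_right (mul_le_mul hk2 hY hY0 (by norm_num)) hν0.le
      _ = 4 * (x ^ (1 - 500 * ρ) * x ^ (500 * ρ)) * ν := by
          have h5 : x ^ (1 - 500 * ρ) * x ^ (500 * ρ) = x := by rw [hmul]; ring_nf; exact hx_one
          rw [h5]; ring
      _ ≤ 4 * (x ^ (1 - 500 * ρ) * H) * ν := by gcongr
      _ = 4 * x ^ (1 - 500 * ρ) * (ν * H) := by ring
  have hA3 : (2 : ℝ) ^ k * xF * G₀ / x ^ (1 / 3 - 1 / 50 : ℝ) ≤ 16 * x ^ (1 + 120 * ρ - (1 / 3 - 1 / 50)) / ν := by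
    have h1 : (2 : ℝ) ^ k ≤ 4 := by
      calc (2 : ℝ) ^ k ≤ 2 ^ 2 := pow_le_pow_right₀ (by norm_num) hk
        _ = 4 := by norm_num
    rw [div_le_div_iff₀ (hxpos _) hν0]
    calc (2 : ℝ) ^ k * xF * G₀ * ν = 2 ^ k * G₀ * (xF * ν) := by ring
      _ ≤ 4 * (2 * x ^ (120 * ρ)) * (2 * x) := by
          rw [hxFν]; exact mul_le_mul_of_nonneg_right (mul_le_mul h1 hG2 (Nat.cast_nonneg _) (by norm_num)) (by linarith)
      _ = 16 * (x ^ (120 * ρ) * x ^ (1 : ℝ)) := by rw [hx_one]; ring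
      _ = 16 * x ^ (1 + 120 * ρ - (1 / 3 - 1 / 50)) * x ^ (1 / 3 - 1 / 50 : ℝ) := by
          rw [hmul, mul_assoc, hmul]; ring_nf
  have hGH : (G₀ : ℝ) ^ (-(1 / 2 : ℝ)) ≤ x ^ (-(60 * ρ)) := by
    calc (G₀ : ℝ) ^ (-(1 / 2 : ℝ)) ≤ (x ^ (120 * ρ)) ^ (-(1 / 2 : ℝ)) :=
          Real.rpow_le_rpow_of_nonpos (hxpos _) hG1 (by norm_num)
      _ = x ^ (-(60 * ρ)) := by rw [← Real.rpow_mul hx0.le]; ring_nf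
  have hTL : ((σ 0 (q * (r * P)) : ℝ) ^ 2) ^ (k + 1) ≤ x ^ (6 * ρ) := by
    have h1 : (σ 0 (q * (r * P)) : ℝ) ≤ x ^ ρ := by
      exact sigma_le_rpow_of hx0 hρ.le hCτ e7 (hLle.trans (hexp (by linarith)))
    have h2 : (1 : ℝ) ≤ σ 0 (q * (r * P)) := by exact_mod_cast one_le_sigma_zero (by omega : q * (r * P) ≠ 0)
    calc ((σ 0 (q * (r * P)) : ℝ) ^ 2) ^ (k + 1) ≤ ((σ 0 (q * (r * P)) : ℝ) ^ 2) ^ 3 :=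
          pow_le_pow_right₀ (one_le_pow₀ h2) (by omega)
      _ = (σ 0 (q * (r * P)) : ℝ) ^ 6 := by ring
      _ ≤ (x ^ ρ) ^ 6 := pow_le_pow_left₀ (Nat.cast_nonneg _) h1 6
      _ = x ^ (6 * ρ) := by rw [pow_rpow_eq hx0.le]; ring_nf
  have hPW : ∏ t, (2 * W t) ≤ 16 * x / ν := by
    rw [Finset.prod_mul_distrib, Finset.prod_const, Finset.card_univ, Fintype.card_fin, le_div_iff₀ hν0]
    have h1 : (2 : ℝ) ^ (k + 1) ≤ 8 := by
      calc (2 : ℝ) ^ (k + 1) ≤ 2 ^ 3 := pow_le_pow_right₀ (by norm_num) (by omega)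
        _ = 8 := by norm_num
    have hP0 : 0 ≤ ∏ t, W t := Finset.prod_nonneg fun t _ => (hW0 t).le
    calc (2 : ℝ) ^ (k + 1) * (∏ t, W t) * ν = 2 ^ (k + 1) * (ν * ∏ t, W t) := by ring
      _ ≤ 8 * (2 * x) := mul_le_mul h1 hνW (by positivity) (by norm_num)
      _ = 16 * x := by ring
  have hRD2 : (x ^ (40 * ρ)) ^ 2 = x ^ (80 * ρ) := by rw [pow_rpow_eq hx0.le]; ring_nf
  have hk3 : (k : ℝ) + 1 ≤ 3 := by linarith
  exact typeI_numerics hx1 hν0 hρ hρ1 hC₀ hρd e1 e2 e3 e4 (by positivity) hC (by positivity)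
    (by positivity) (Finset.sum_nonneg fun _ _ => inv_nonneg.2 (Nat.cast_nonneg _)) (by positivity) (by positivity)
    (Finset.sum_nonneg fun _ _ => by positivity)
    (Finset.prod_nonneg fun t _ => by linarith [hW0 t]) (by positivity) (by positivity)
    (Finset.sum_nonneg fun _ _ => by positivity)
    hGLk hHk hLC₀ hXF hΦle hA2 hA3 rfl hRD2 hΨle hk3 hPW hTL hGH rfl hΨ₁le

/-- Landing anchor of the `𝔲_R`-bound chain, file 8; registered stub `urbChain8_anchor` of the crux item (the
mathematical content of this file is `typeI_B_le`). -/
theorem urbChain8_anchor : True := trivial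

end Summit.Parity.GeneralizedHardyLittlewood.Cruxes.TypeI2Dilated.PeelToDrappeau

end
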